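import Summits.MatrixMultiplication.OmegaCensus.DicyclicClassBGeneralCore
import Summits.MatrixMultiplication.OmegaCensus.DicyclicClassBParseval
import Summits.MatrixMultiplication.OmegaCensus.CubeLawParityRank
import HarnessLib

/-!
# Class B (`(s,s),(t,t),(u,u)`) of the dicyclic-law triples is dead for EVERY quotient `A/⟨c₀⟩` of `2`-rank `≥ 3`

ω-census `pub-omega`, family (b3), seat pub-omega-group gen 13.  Framing: lottery ticket; floor = certified bounds/negative
ranges.  VALUE: kernel theorems about the group-theoretic method (TPP capacity of dihedral-like groups); NOT progress on ω.

Gen 12 (`DicyclicClassBStable.no_classB_dicyclic_law`) killed the balanced class B when `A/⟨c₀⟩` is a `2`-group (the even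
member is `ρ(c₀)`-stable).  For a general quotient the transfer over `Ψ = (ψ₁,ψ₂,ψ₃) : A → V = 𝔽₂³` only makes the
`Ψ`-fibre counts of `U₀, U₁` even (`classB_even_fibres`); this file finishes with the **real-character parity of
`CubeLawParity` in slack two**: for every `w ≠ 0` in `V` and `χ = (−1)^{w·Ψ}` the part sums `σᵢ = χ(Sᵢ)`, `πⱼ = χ(Tⱼ)` are odd
and `ξₗ = χ(Uₗ) = 2ηₗ` with `ηₗ` odd (even fibres, `u ≡ 2 (mod 4)`); the eight vertex identities
`∑_{e∼m} σπξ ∈ {0, ±2}` (`vertex000/111_sgnSum_two` on the triple and its `τ0`-translates, `χ(c₀) = 1`) give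
`∑_{e∼m} σπη = ±1` at every vertex, hence `3σ₀π₀η₀ = ±1±1±1 ∓ 2`, so `σ₀π₀η₀ = ±1` and `σᵢ, πⱼ = ±1`, `ξₗ = ±2`.
Parseval over `V` (`f2cube_parseval`): `s² + 7 = 8∑n_v²` forces `s ≡ ±1 (mod 8)`, likewise `t`, and for `u = 2v` with all
fibre counts even `v² + 7 = 8∑m_v²` forces `v ≡ ±1 (mod 8)`; but `16 ∣ |A| = 6stv + 2` (the kernel of `Ψ` contains
`{0, c₀}`) means `stv ≡ 5 (mod 8)` — contradiction.

**Theorem (`no_classB_dicyclic_law_general`).** Dicyclic type, `c₀ ≠ 0`, `A/⟨c₀⟩ ↠ 𝔽₂³` (no `2`-group hypothesis): no TPP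
triple with `|S₀| = |S₁|`, `|T₀| = |T₁|`, `|U₀| = |U₁|` attains `3|S||T||U| + 16 = 8|A|`.
-/

namespace Summit.MatrixMultiplication.OmegaCensus

open Literature.Combinatorics.Additive Finset

section ClassB

variable {A : Type} [AddCommGroup A] [DecidableEq A] [Fintype A] {G : Type} [Group G] [DecidableEq G]
  {ρ τ : A → G} {c₀ : A}

/-- **Class B with `U` the even member: contradiction** (see the module docstring). [folklore] -/
theorem classB_general_aux
    (hρρ : ∀ a b, ρ a * ρ b = ρ (a + b)) (hρτ : ∀ a b, ρ a * τ b = τ (b - a))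
    (hτρ : ∀ a b, τ a * ρ b = τ (a + b)) (hττ : ∀ a b, τ a * τ b = ρ (c₀ + b - a)) (hc₀ : c₀ ≠ 0)
    (hρ : Function.Injective ρ) (hτ : Function.Injective τ) (hne : ∀ a b, ρ a ≠ τ b)
    (ψ₁ ψ₂ ψ₃ : A →+ ZMod 2) (hψc : ψ₁ c₀ = 0 ∧ ψ₂ c₀ = 0 ∧ ψ₃ c₀ = 0)
    (hψ : ∀ v : ZMod 2 × ZMod 2 × ZMod 2, ∃ x, (ψ₁ x, ψ₂ x, ψ₃ x) = v)
    {S T U : Finset G} (h : TripleProductProperty S T U) {s t u : ℕ}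
    (hs₀ : (univ.filter fun a : A => ρ a ∈ S).card = s) (hs₁ : (univ.filter fun a : A => τ a ∈ S).card = s)
    (ht₀ : (univ.filter fun a : A => ρ a ∈ T).card = t) (ht₁ : (univ.filter fun a : A => τ a ∈ T).card = t)
    (hu₀ : (univ.filter fun a : A => ρ a ∈ U).card = u) (hu₁ : (univ.filter fun a : A => τ a ∈ U).card = u)
    (hs : Odd s) (ht : Odd t) (hu : Even u) (hN : Fintype.card A = 3 * (s * t * u) + 2) : False := by
  classical
  set S₀ : Finset A := univ.filter fun a => ρ a ∈ S with hS₀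
  set S₁ : Finset A := univ.filter fun a => τ a ∈ S with hS₁
  set T₀ : Finset A := univ.filter fun a => ρ a ∈ T with hT₀
  set T₁ : Finset A := univ.filter fun a => τ a ∈ T with hT₁
  set U₀ : Finset A := univ.filter fun a => ρ a ∈ U with hU₀
  set U₁ : Finset A := univ.filter fun a => τ a ∈ U with hU₁
  have h2c := two_c0_eq_zero hρτ hτρ hττ hτ
  obtain ⟨v, hv⟩ := hu; obtain ⟨r, hr⟩ := hs; obtain ⟨r', hr'⟩ := ht
  -- the map `Ψ`
  let Ψ : A →+ ZMod 2 × ZMod 2 × ZMod 2 := ψ₁.prod (ψ₂.prod ψ₃)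
  have hΨ : ∀ a, Ψ a = (ψ₁ a, ψ₂ a, ψ₃ a) := fun a => rfl
  have hΨc : Ψ c₀ = 0 := by rw [hΨ, hψc.1, hψc.2.1, hψc.2.2]; rfl
  have hΨsurj : Function.Surjective Ψ := fun x => by
    obtain ⟨a, ha⟩ := hψ x
    exact ⟨a, by rw [hΨ]; exact ha⟩
  -- `16 ∣ |A|`, i.e. `stv ≡ 5 (mod 8)`
  have hK : (univ.filter fun a : A => Ψ a = 0).image (· + c₀) = (univ.filter fun a : A => Ψ a = 0) := by
    apply eq_of_subset_of_card_le _ (by rw [card_image_of_injective _ (add_left_injective c₀)])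
    intro x hx
    obtain ⟨a, ha, rfl⟩ := mem_image.1 hx
    have ha0 := (mem_filter.1 ha).2
    exact mem_filter.2 ⟨mem_univ _, by rw [map_add, ha0, hΨc, add_zero]⟩
  obtain ⟨q, hq⟩ := card_even_of_periodic hK hc₀ h2c
  have hcardA := DihedralLikeGroup.card_ker_mul_card Ψ hΨsurj
  have hV8 : Fintype.card (ZMod 2 × ZMod 2 × ZMod 2) = 8 := by simp [Fintype.card_prod, ZMod.card]
  rw [hV8, hq] at hcardA
  set P := s * t * v with hP
  have hP5 : P % 8 = 5 := by
    have : Fintype.card A = 6 * P + 2 := by rw [hN, hv, hP]; ring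
    omega
  -- even `Ψ`-fibres of `U₀`, `U₁`
  obtain ⟨evU₀, -⟩ := classB_even_fibres hρρ hρτ hτρ hττ hc₀ hρ hτ hne Ψ hΨc f2cube_two_nsmul h hs₀ hs₁ ht₀ ht₁ hu₀
    hu₁ ⟨r, hr⟩ ⟨r', hr'⟩ ⟨v, hv⟩ (le_of_eq hN)
  -- the sign characters
  let sg : ZMod 2 × ZMod 2 × ZMod 2 → ZMod 2 × ZMod 2 × ZMod 2 → ℤ :=
    fun w x => if w.1 * x.1 + w.2.1 * x.2.1 + w.2.2 * x.2.2 = 0 then 1 else -1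
  -- translated triples and part bookkeeping
  have er : (Equiv.mulRight (1 : G)).toEmbedding = Function.Embedding.refl G := by ext x; simp
  have hS' := h.map_mulRight (τ 0) 1 1
  have hT' := h.map_mulRight 1 (τ 0) 1
  have hU' := h.map_mulRight 1 1 (τ 0)
  simp only [er, Finset.map_refl] at hS' hT' hU'
  have cρ := card_rho_part_mulRight_tau hρρ hρτ hττ (A := A)
  have cτ := card_tau_part_mulRight_tau hρρ hττ (A := A)
  have hN' : s * t * u + s * t * u + s * t * u + 2 = Fintype.card A := by rw [hN]; ring
  -- for every non-zero `w`: `χ_w(S₀)² = χ_w(T₀)² = 1`, `χ_w(U₀)² = 4`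
  have hsq : ∀ w : ZMod 2 × ZMod 2 × ZMod 2, w ≠ 0 →
      (∑ a ∈ S₀, sg w (Ψ a)) ^ 2 = 1 ∧ (∑ a ∈ T₀, sg w (Ψ a)) ^ 2 = 1 ∧ (∑ a ∈ U₀, sg w (Ψ a)) ^ 2 = 4 := by
    intro w hw
    let φ : A →+ ZMod 2 :=
      { toFun := fun a => w.1 * ψ₁ a + w.2.1 * ψ₂ a + w.2.2 * ψ₃ a
        map_zero' := by simp
        map_add' := fun a b => by simp only [map_add]; ring }
    have hφΨ : ∀ a, φ a = w.1 * (Ψ a).1 + w.2.1 * (Ψ a).2.1 + w.2.2 * (Ψ a).2.2 := fun a => rfl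
    have hφc : φ c₀ = 0 := by
      show w.1 * ψ₁ c₀ + w.2.1 * ψ₂ c₀ + w.2.2 * ψ₃ c₀ = 0
      rw [hψc.1, hψc.2.1, hψc.2.2]; ring
    obtain ⟨z, hz⟩ := f2cube_exists_pair_one w hw
    obtain ⟨a₁, ha₁⟩ := hψ z
    have hφ : ∃ a, φ a ≠ 0 := by
      refine ⟨a₁, ?_⟩
      show w.1 * ψ₁ a₁ + w.2.1 * ψ₂ a₁ + w.2.2 * ψ₃ a₁ ≠ 0
      have h1 : ψ₁ a₁ = z.1 := congrArg Prod.fst ha₁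
      have h2 : ψ₂ a₁ = z.2.1 := congrArg (fun p => p.2.1) ha₁
      have h3 : ψ₃ a₁ = z.2.2 := congrArg (fun p => p.2.2) ha₁
      rw [h1, h2, h3, hz]
      exact one_ne_zero
    have hval : ∀ a, (fun a => if φ a = 0 then (1 : ℤ) else -1) a = 1 ∨
        (fun a => if φ a = 0 then (1 : ℤ) else -1) a = -1 := fun a => by
      simp only; split_ifs
      · exact Or.inl rfl
      · exact Or.inr rfl
    have hmul : ∀ a b, (fun a => if φ a = 0 then (1 : ℤ) else -1) (a + b) =
        (fun a => if φ a = 0 then (1 : ℤ) else -1) a * (fun a => if φ a = 0 then (1 : ℤ) else -1) b := by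
      intro a b
      show sg w (Ψ (a + b)) = sg w (Ψ a) * sg w (Ψ b)
      rw [map_add, f2cube_mul]
    have hsum : ∑ a, (fun a => if φ a = 0 then (1 : ℤ) else -1) a = 0 := homSgn_sum φ hφ
    have hγ : (if φ c₀ = 0 then (1 : ℤ) else -1) = 1 := by rw [if_pos hφc]
    -- the eight vertex identities
    have E1 := vertex000_sgnSum_two hρρ hρτ hτρ hττ hρ hτ hne h hmul hval hsum
      (by rw [hs₀, hs₁, ht₀, ht₁, hu₀, hu₁]; exact hN')
    have E2 := vertex111_sgnSum_two hρρ hρτ hτρ hττ hρ hτ hne h hmul hval hsum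
      (by rw [hs₀, hs₁, ht₀, ht₁, hu₀, hu₁]; exact hN')
    have E3 := vertex000_sgnSum_two hρρ hρτ hτρ hττ hρ hτ hne hS' hmul hval hsum
      (by rw [cρ, cτ, hs₀, hs₁, ht₀, ht₁, hu₀, hu₁]; exact hN')
    have E4 := vertex111_sgnSum_two hρρ hρτ hτρ hττ hρ hτ hne hS' hmul hval hsum
      (by rw [cρ, cτ, hs₀, hs₁, ht₀, ht₁, hu₀, hu₁]; exact hN')
    have E5 := vertex000_sgnSum_two hρρ hρτ hτρ hττ hρ hτ hne hT' hmul hval hsum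
      (by rw [cρ, cτ, hs₀, hs₁, ht₀, ht₁, hu₀, hu₁]; exact hN')
    have E6 := vertex111_sgnSum_two hρρ hρτ hτρ hττ hρ hτ hne hT' hmul hval hsum
      (by rw [cρ, cτ, hs₀, hs₁, ht₀, ht₁, hu₀, hu₁]; exact hN')
    have E7 := vertex000_sgnSum_two hρρ hρτ hτρ hττ hρ hτ hne hU' hmul hval hsum
      (by rw [cρ, cτ, hs₀, hs₁, ht₀, ht₁, hu₀, hu₁]; exact hN')
    have E8 := vertex111_sgnSum_two hρρ hρτ hτρ hττ hρ hτ hne hU' hmul hval hsum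
      (by rw [cρ, cτ, hs₀, hs₁, ht₀, ht₁, hu₀, hu₁]; exact hN')
    obtain ⟨pSρ, pSτ⟩ := partSum_mulRight_tau hρρ hρτ hττ hmul hval S
    obtain ⟨pTρ, pTτ⟩ := partSum_mulRight_tau hρρ hρτ hττ hmul hval T; obtain ⟨pUρ, pUτ⟩ := partSum_mulRight_tau hρρ hρτ hττ hmul hval U
    rw [pSρ, pSτ, hγ, one_mul] at E3 E4
    rw [pTρ, pTτ, hγ, one_mul] at E5 E6
    rw [pUρ, pUτ, hγ, one_mul] at E7 E8
    set σ₀ := (∑ a ∈ S₀, (if φ a = 0 then (1 : ℤ) else -1)) with hσ₀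
    set σ₁ := (∑ a ∈ S₁, (if φ a = 0 then (1 : ℤ) else -1)) with hσ₁
    set π₀ := (∑ a ∈ T₀, (if φ a = 0 then (1 : ℤ) else -1)) with hπ₀
    set π₁ := (∑ a ∈ T₁, (if φ a = 0 then (1 : ℤ) else -1)) with hπ₁
    set ξ₀ := (∑ a ∈ U₀, (if φ a = 0 then (1 : ℤ) else -1)) with hξ₀
    set ξ₁ := (∑ a ∈ U₁, (if φ a = 0 then (1 : ℤ) else -1)) with hξ₁
    -- parities of the part sums
    have oσ₀ : Odd σ₀ := by
      refine ⟨(r : ℤ) - ((S₀.filter fun a => φ a ≠ 0).card : ℤ), ?_⟩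
      rw [hσ₀, sgnSum_eq_card_sub φ S₀, hs₀, hr]; push_cast; ring
    have oσ₁ : Odd σ₁ := by
      refine ⟨(r : ℤ) - ((S₁.filter fun a => φ a ≠ 0).card : ℤ), ?_⟩
      rw [hσ₁, sgnSum_eq_card_sub φ S₁, hs₁, hr]; push_cast; ring
    have oπ₀ : Odd π₀ := by
      refine ⟨(r' : ℤ) - ((T₀.filter fun a => φ a ≠ 0).card : ℤ), ?_⟩
      rw [hπ₀, sgnSum_eq_card_sub φ T₀, ht₀, hr']; push_cast; ring
    have oπ₁ : Odd π₁ := by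
      refine ⟨(r' : ℤ) - ((T₁.filter fun a => φ a ≠ 0).card : ℤ), ?_⟩
      rw [hπ₁, sgnSum_eq_card_sub φ T₁, ht₁, hr']; push_cast; ring
    -- `#{a ∈ U_l : φ a ≠ 0}` is even (it is a union of `Ψ`-fibres)
    have hneg : ∀ X : Finset A, (∀ z, 2 ∣ (X.filter fun a => Ψ a = z).card) →
        2 ∣ (X.filter fun a => φ a ≠ 0).card := by
      intro X hev
      rw [card_eq_sum_card_fiberwise (f := Ψ) (s := X.filter fun a => φ a ≠ 0) (t := univ) fun _ _ => mem_univ _]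
      refine dvd_sum fun z _ => ?_
      by_cases hz : w.1 * z.1 + w.2.1 * z.2.1 + w.2.2 * z.2.2 = 0
      · have : ((X.filter fun a => φ a ≠ 0).filter fun a => Ψ a = z) = ∅ := by
          apply filter_eq_empty_iff.2
          intro a ha haz
          apply (mem_filter.1 ha).2
          rw [hφΨ, haz]; exact hz
        rw [this, card_empty]; exact dvd_zero 2
      · have : ((X.filter fun a => φ a ≠ 0).filter fun a => Ψ a = z) = X.filter fun a => Ψ a = z := by
          ext a
          simp only [mem_filter]
          constructor
          · rintro ⟨⟨h1, -⟩, h3⟩; exact ⟨h1, h3⟩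
          · rintro ⟨h1, h3⟩; exact ⟨⟨h1, by rw [hφΨ, h3]; exact hz⟩, h3⟩
        rw [this]; exact hev z
    obtain ⟨evU₀', evU₁'⟩ := classB_even_fibres hρρ hρτ hτρ hττ hc₀ hρ hτ hne Ψ hΨc f2cube_two_nsmul h hs₀ hs₁ ht₀
      ht₁ hu₀ hu₁ ⟨r, hr⟩ ⟨r', hr'⟩ ⟨v, hv⟩ (le_of_eq hN)
    obtain ⟨f₀, hf₀⟩ := hneg U₀ evU₀'
    obtain ⟨f₁, hf₁⟩ := hneg U₁ evU₁'
    -- `ξ_l = 2 η_l` with `η_l` odd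
    have hξ₀' : ξ₀ = 2 * ((v : ℤ) - 2 * f₀) := by
      rw [hξ₀, sgnSum_eq_card_sub φ U₀, hu₀, hv, hf₀]; push_cast; ring
    have hξ₁' : ξ₁ = 2 * ((v : ℤ) - 2 * f₁) := by
      rw [hξ₁, sgnSum_eq_card_sub φ U₁, hu₁, hv, hf₁]; push_cast; ring
    set η₀ : ℤ := (v : ℤ) - 2 * f₀ with hη₀
    set η₁ : ℤ := (v : ℤ) - 2 * f₁ with hη₁
    have hvodd : Odd v := by
      rcases Nat.even_or_odd v with hve | hvo
      · exfalso; obtain ⟨c, hc⟩ := hve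
        have : P = 2 * (s * t * c) := by rw [hP, hc]; ring
        omega
      · exact hvo
    have oη₀ : Odd η₀ := by
      obtain ⟨c, hc⟩ := hvodd
      exact ⟨(c : ℤ) - f₀, by rw [hη₀, hc]; push_cast; ring⟩
    have oη₁ : Odd η₁ := by
      obtain ⟨c, hc⟩ := hvodd
      exact ⟨(c : ℤ) - f₁, by rw [hη₁, hc]; push_cast; ring⟩
    rw [hξ₀', hξ₁'] at E1 E2 E3 E4 E5 E6 E7 E8
    -- the eight box products `σπη` are odd
    have o000 := (oσ₀.mul oπ₀).mul oη₀
    have o001 := (oσ₀.mul oπ₀).mul oη₁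
    have o010 := (oσ₀.mul oπ₁).mul oη₀
    have o011 := (oσ₀.mul oπ₁).mul oη₁
    have o100 := (oσ₁.mul oπ₀).mul oη₀
    have o101 := (oσ₁.mul oπ₀).mul oη₁
    have o110 := (oσ₁.mul oπ₁).mul oη₀
    have o111 := (oσ₁.mul oπ₁).mul oη₁
    -- the vertex sums `∑ σπη` are `±1`
    have toW : ∀ (a b c : ℤ), Odd a → Odd b → Odd c →
        (2 * (a + b + c) = 0 ∨ 2 * (a + b + c) = 2 ∨ 2 * (a + b + c) = -2) → (a + b + c = 1 ∨ a + b + c = -1) := by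
      rintro a b c ⟨x, rfl⟩ ⟨y, rfl⟩ ⟨z, rfl⟩ h'; omega
    have W000 := toW _ _ _ o100 o010 o001 (by
      have e : 2 * (σ₁ * π₀ * η₀ + σ₀ * π₁ * η₀ + σ₀ * π₀ * η₁) =
        σ₁ * π₀ * (2 * η₀) + σ₀ * π₁ * (2 * η₀) + σ₀ * π₀ * (2 * η₁) := by ring
      rw [e]; exact E1)
    have W111 := toW _ _ _ o011 o101 o110 (by
      have e : 2 * (σ₀ * π₁ * η₁ + σ₁ * π₀ * η₁ + σ₁ * π₁ * η₀) =
        σ₀ * π₁ * (2 * η₁) + σ₁ * π₀ * (2 * η₁) + σ₁ * π₁ * (2 * η₀) := by ring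
      rw [e]; exact E2)
    have W100 := toW _ _ _ o000 o110 o101 (by
      have e : 2 * (σ₀ * π₀ * η₀ + σ₁ * π₁ * η₀ + σ₁ * π₀ * η₁) =
        σ₀ * π₀ * (2 * η₀) + σ₁ * π₁ * (2 * η₀) + σ₁ * π₀ * (2 * η₁) := by ring
      rw [e]; exact E3)
    have W011 := toW _ _ _ o111 o001 o010 (by
      have e : 2 * (σ₁ * π₁ * η₁ + σ₀ * π₀ * η₁ + σ₀ * π₁ * η₀) =
        σ₁ * π₁ * (2 * η₁) + σ₀ * π₀ * (2 * η₁) + σ₀ * π₁ * (2 * η₀) := by ring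
      rw [e]; exact E4)
    have W010 := toW _ _ _ o110 o000 o011 (by
      have e : 2 * (σ₁ * π₁ * η₀ + σ₀ * π₀ * η₀ + σ₀ * π₁ * η₁) =
        σ₁ * π₁ * (2 * η₀) + σ₀ * π₀ * (2 * η₀) + σ₀ * π₁ * (2 * η₁) := by ring
      rw [e]; exact E5)
    have W101 := toW _ _ _ o001 o111 o100 (by
      have e : 2 * (σ₀ * π₀ * η₁ + σ₁ * π₁ * η₁ + σ₁ * π₀ * η₀) =
        σ₀ * π₀ * (2 * η₁) + σ₁ * π₁ * (2 * η₁) + σ₁ * π₀ * (2 * η₀) := by ring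
      rw [e]; exact E6)
    have W001 := toW _ _ _ o101 o011 o000 (by
      have e : 2 * (σ₁ * π₀ * η₁ + σ₀ * π₁ * η₁ + σ₀ * π₀ * η₀) =
        σ₁ * π₀ * (2 * η₁) + σ₀ * π₁ * (2 * η₁) + σ₀ * π₀ * (2 * η₀) := by ring
      rw [e]; exact E7)
    have W110 := toW _ _ _ o010 o100 o111 (by
      have e : 2 * (σ₀ * π₁ * η₀ + σ₁ * π₀ * η₀ + σ₁ * π₁ * η₁) =
        σ₀ * π₁ * (2 * η₀) + σ₁ * π₀ * (2 * η₀) + σ₁ * π₁ * (2 * η₁) := by ring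
      rw [e]; exact E8)
    obtain ⟨k₀, hk₀⟩ := o000; obtain ⟨k₇, hk₇⟩ := o111
    generalize hP000 : σ₀ * π₀ * η₀ = P000 at *
    generalize hP001 : σ₀ * π₀ * η₁ = P001 at *
    generalize hP010 : σ₀ * π₁ * η₀ = P010 at *
    generalize hP011 : σ₀ * π₁ * η₁ = P011 at *
    generalize hP100 : σ₁ * π₀ * η₀ = P100 at *
    generalize hP101 : σ₁ * π₀ * η₁ = P101 at *
    generalize hP110 : σ₁ * π₁ * η₀ = P110 at *
    generalize hP111 : σ₁ * π₁ * η₁ = P111 at *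
    have b000 : P000 = 1 ∨ P000 = -1 := by
      rcases W100 with a | a <;> rcases W010 with b | b <;> rcases W001 with c | c <;> rcases W111 with d | d <;> omega
    rw [← hP000] at b000
    obtain ⟨hσ₀v, hπ₀v, hη₀v⟩ := pm_one_of_mul₃ b000
    show σ₀ ^ 2 = 1 ∧ π₀ ^ 2 = 1 ∧ ξ₀ ^ 2 = 4
    refine ⟨?_, ?_, ?_⟩
    · rcases hσ₀v with e | e <;> rw [e] <;> norm_num
    · rcases hπ₀v with e | e <;> rw [e] <;> norm_num
    · rw [hξ₀']
      rcases hη₀v with e | e <;> rw [e] <;> norm_num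
  -- Parseval for `S₀`, `T₀`, `U₀`
  have h0 : ∀ X : Finset A, (∑ a ∈ X, sg 0 (Ψ a)) = X.card := by
    intro X
    simp only [sg, Prod.fst_zero, Prod.snd_zero, zero_mul, add_zero, ↓reduceIte, sum_const, nsmul_eq_mul, mul_one]
  have hsplit : ∀ X : Finset A, ∀ c : ℤ, (∀ w : ZMod 2 × ZMod 2 × ZMod 2, w ≠ 0 → (∑ a ∈ X, sg w (Ψ a)) ^ 2 = c) →
      (∑ w : ZMod 2 × ZMod 2 × ZMod 2, (∑ a ∈ X, sg w (Ψ a)) ^ 2) = (X.card : ℤ) ^ 2 + 7 * c := by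
    intro X c hc
    rw [← Finset.sum_filter_add_sum_filter_not univ (fun w => w ≠ 0)]
    have hA7 : (∑ w ∈ univ.filter (fun w : ZMod 2 × ZMod 2 × ZMod 2 => w ≠ 0), (∑ a ∈ X, sg w (Ψ a)) ^ 2) = 7 * c := by
      rw [sum_congr rfl fun w hw => hc w (mem_filter.1 hw).2, sum_const, f2cube_card_ne_zero]
      simp
    have hB : (univ.filter fun w : ZMod 2 × ZMod 2 × ZMod 2 => ¬w ≠ 0) = {0} := by
      ext w; simp
    rw [hA7, hB, sum_singleton, h0]
    ring
  have parsS := f2cube_parseval Ψ S₀; have parsT := f2cube_parseval Ψ T₀; have parsU := f2cube_parseval Ψ U₀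
  rw [hsplit S₀ 1 fun w hw => (hsq w hw).1] at parsS
  rw [hsplit T₀ 1 fun w hw => (hsq w hw).2.1] at parsT
  rw [hsplit U₀ 4 fun w hw => (hsq w hw).2.2] at parsU
  -- `s ≡ ±1`, `t ≡ ±1 (mod 8)`
  have fibS := card_eq_sum_fibres Ψ S₀; have fibT := card_eq_sum_fibres Ψ T₀; have fibU := card_eq_sum_fibres Ψ U₀
  set nS := fun z : ZMod 2 × ZMod 2 × ZMod 2 => (S₀.filter fun x => Ψ x = z).card with hnS
  set nT := fun z : ZMod 2 × ZMod 2 × ZMod 2 => (T₀.filter fun x => Ψ x = z).card with hnT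
  set nU := fun z : ZMod 2 × ZMod 2 × ZMod 2 => (U₀.filter fun x => Ψ x = z).card with hnU
  have hsmod : s % 8 = 1 ∨ s % 8 = 7 := by
    have key : (s : ℤ) ^ 2 + 7 = 8 * ∑ z, (nS z : ℤ) * nS z := by
      have := parsS; rw [hs₀] at this; simpa [hnS] using this
    have keyN : s ^ 2 + 7 = 8 * ∑ z, nS z * nS z := by exact_mod_cast key
    refine mod_eight_of_sq_add_seven keyN ?_
    have := even_sum_sq_add_sum (univ : Finset (ZMod 2 × ZMod 2 × ZMod 2)) nS
    rw [← hs₀, fibS]; exact this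
  have htmod : t % 8 = 1 ∨ t % 8 = 7 := by
    have key : (t : ℤ) ^ 2 + 7 = 8 * ∑ z, (nT z : ℤ) * nT z := by
      have := parsT; rw [ht₀] at this; simpa [hnT] using this
    have keyN : t ^ 2 + 7 = 8 * ∑ z, nT z * nT z := by exact_mod_cast key
    refine mod_eight_of_sq_add_seven keyN ?_
    have := even_sum_sq_add_sum (univ : Finset (ZMod 2 × ZMod 2 × ZMod 2)) nT
    rw [← ht₀, fibT]; exact this
  -- `v ≡ ±1 (mod 8)` (all fibre counts of `U₀` are even)
  have hvmod : v % 8 = 1 ∨ v % 8 = 7 := by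
    set mU := fun z : ZMod 2 × ZMod 2 × ZMod 2 => nU z / 2 with hmU
    have hnm : ∀ z, nU z = 2 * mU z := fun z => by
      obtain ⟨c, hc⟩ := evU₀ z
      show nU z = 2 * (nU z / 2)
      have : nU z = 2 * c := hc
      omega
    have key : (u : ℤ) ^ 2 + 7 * 4 = 8 * ∑ z, (nU z : ℤ) * nU z := by
      have := parsU; rw [hu₀] at this; simpa [hnU] using this
    have keyN : u ^ 2 + 28 = 8 * ∑ z, nU z * nU z := by exact_mod_cast key
    have hsum2 : ∑ z, nU z * nU z = 4 * ∑ z, mU z * mU z := by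
      rw [mul_sum]; exact sum_congr rfl fun z _ => by rw [hnm z]; ring
    have hsum1 : u = 2 * ∑ z, mU z := by
      rw [← hu₀, fibU, mul_sum]; exact sum_congr rfl fun z _ => hnm z
    set M := ∑ z, mU z * mU z with hM
    set W := ∑ z, mU z with hW
    have hvW : v = W := by omega
    have keyW : (2 * W) ^ 2 + 28 = 8 * (4 * M) := by rw [← hsum1, ← hsum2]; exact keyN
    have e4 : (2 * W) ^ 2 = 4 * W ^ 2 := by ring
    rw [e4] at keyW
    have keyv : W ^ 2 + 7 = 8 * M := by omega
    rw [hvW]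
    exact mod_eight_of_sq_add_seven keyv (by rw [hM, hW]; exact even_sum_sq_add_sum _ mU)
  -- the contradiction `stv ≡ 5 (mod 8)`
  have hmul : P % 8 = ((s % 8) * (t % 8) % 8) * (v % 8) % 8 := by
    rw [hP, Nat.mul_mod, Nat.mul_mod s t]
  rcases hsmod with a | a <;> rcases htmod with b | b <;> rcases hvmod with c | c <;>
    rw [a, b, c] at hmul <;> omega

/-- **No class-B dicyclic-law triple for ANY `A/⟨c₀⟩` of `2`-rank `≥ 3`** (see the module docstring): dicyclic type
(`c₀ ≠ 0`), three homomorphisms `A →+ ZMod 2` killing `c₀` jointly onto `𝔽₂³`; no TPP triple with balanced parts attains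
`3|S||T||U| + 16 = 8|A|`.  (The law gives `|A| = 3stu + 2`, `8 ∣ |A|` makes exactly one of `s, t, u` even; rotate it into
third position and apply `classB_general_aux`.) [folklore] -/
theorem no_classB_dicyclic_law_general
    (hρρ : ∀ a b, ρ a * ρ b = ρ (a + b)) (hρτ : ∀ a b, ρ a * τ b = τ (b - a))
    (hτρ : ∀ a b, τ a * ρ b = τ (a + b)) (hττ : ∀ a b, τ a * τ b = ρ (c₀ + b - a)) (hc₀ : c₀ ≠ 0)
    (hρ : Function.Injective ρ) (hτ : Function.Injective τ) (hne : ∀ a b, ρ a ≠ τ b)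
    (hsurj : ∀ g, (∃ a, ρ a = g) ∨ (∃ a, τ a = g))
    (ψ₁ ψ₂ ψ₃ : A →+ ZMod 2) (hψc : ψ₁ c₀ = 0 ∧ ψ₂ c₀ = 0 ∧ ψ₃ c₀ = 0)
    (hψ : ∀ v : ZMod 2 × ZMod 2 × ZMod 2, ∃ x, (ψ₁ x, ψ₂ x, ψ₃ x) = v)
    {S T U : Finset G} (h : TripleProductProperty S T U)
    (hs : (univ.filter fun a : A => ρ a ∈ S).card = (univ.filter fun a : A => τ a ∈ S).card)
    (ht : (univ.filter fun a : A => ρ a ∈ T).card = (univ.filter fun a : A => τ a ∈ T).card)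
    (hu : (univ.filter fun a : A => ρ a ∈ U).card = (univ.filter fun a : A => τ a ∈ U).card) :
    3 * (S.card * T.card * U.card) + 16 ≠ 8 * Fintype.card A := by
  intro hV
  set s := (univ.filter fun a : A => ρ a ∈ S).card with hsd
  set t := (univ.filter fun a : A => ρ a ∈ T).card with htd
  set u := (univ.filter fun a : A => ρ a ∈ U).card with hud
  have cS : S.card = s + s := by rw [card_eq_parts' hρ hτ hne hsurj S, ← hs]
  have cT : T.card = t + t := by rw [card_eq_parts' hρ hτ hne hsurj T, ← ht]
  have cU : U.card = u + u := by rw [card_eq_parts' hρ hτ hne hsurj U, ← hu]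
  have hV' := hV
  rw [cS, cT, cU, show (s + s) * (t + t) * (u + u) = 8 * (s * t * u) by ring] at hV'
  have hN : Fintype.card A = 3 * (s * t * u) + 2 := by omega
  obtain ⟨q, hq⟩ := eight_dvd_card_of_onto ψ₁ ψ₂ ψ₃ hψ
  have hP : s * t * u % 8 = 2 := by omega
  rcases Nat.even_or_odd s with hse | hso <;> rcases Nat.even_or_odd t with hte | hto <;>
    rcases Nat.even_or_odd u with hue | huo
  · obtain ⟨a, ha⟩ := hse; obtain ⟨b, hb⟩ := hte
    rw [ha, hb, show (a + a) * (b + b) * u = 4 * (a * b * u) by ring] at hP; omega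
  · obtain ⟨a, ha⟩ := hse; obtain ⟨b, hb⟩ := hte
    rw [ha, hb, show (a + a) * (b + b) * u = 4 * (a * b * u) by ring] at hP; omega
  · obtain ⟨a, ha⟩ := hse; obtain ⟨b, hb⟩ := hue
    rw [ha, hb, show (a + a) * t * (b + b) = 4 * (a * t * b) by ring] at hP; omega
  · -- `s` even: rotate to `(T, U, S)`
    exact classB_general_aux hρρ hρτ hτρ hττ hc₀ hρ hτ hne ψ₁ ψ₂ ψ₃ hψc hψ h.rotate htd.symm ht.symm hud.symm hu.symm
      hsd.symm hs.symm hto huo hse (by rw [hN]; ring)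
  · obtain ⟨a, ha⟩ := hte; obtain ⟨b, hb⟩ := hue
    rw [ha, hb, show s * (a + a) * (b + b) = 4 * (s * a * b) by ring] at hP; omega
  · -- `t` even: rotate to `(U, S, T)`
    exact classB_general_aux hρρ hρτ hτρ hττ hc₀ hρ hτ hne ψ₁ ψ₂ ψ₃ hψc hψ h.rotate.rotate hud.symm hu.symm hsd.symm
      hs.symm htd.symm ht.symm huo hso hte (by rw [hN]; ring)
  · -- `u` even
    exact classB_general_aux hρρ hρτ hτρ hττ hc₀ hρ hτ hne ψ₁ ψ₂ ψ₃ hψc hψ h hsd.symm hs.symm htd.symm ht.symm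
      hud.symm hu.symm hso hto hue hN
  · have hodd : Odd (s * t * u) := (hso.mul hto).mul huo
    obtain ⟨r, hr⟩ := hodd
    omega

end ClassB

end Summit.MatrixMultiplication.OmegaCensus
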